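import Summits.BirchSwinnertonDyer.Rank1Residual.Additive.TameBranchFunctionalEquation
import HarnessLib

/-!
# Class N10, tame branch: TUPLE RIGIDITY of the E-normalised tame branch — a non-zero bounded
# witness of `IsTameBranchOf f p ε α B` determines the WHOLE tuple `(ε, α, B)`
# (cell `b2b-bsdres`, sub-cell additive-p2, gen 21; file 3 of 3, after `TameBranchRigidityDescent.lean`
# and `TameBranchFunctionalEquation.lean`)

HONEST FRAMING (cell `b2b-bsdres`, run/shared/lean/b2b/bsd-rank1-residual/, verbatim in every
file): the goal of the cell is to DELETE the COMBINATION-SHAPED residual classes of the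
Birch–Swinnerton-Dyer formula for ALL analytic-rank `≤ 1` elliptic curves over `ℚ` — "full BSD
formula for every rank `≤ 1` curve in class `C`" assembled STRICTLY from published theorems — so
that the rank-`≤ 1` remainder becomes exactly the CONSTRUCTION-SHAPED classes, which are TYPED
(missing-input `Prop`s), NOT attempted. This is not "finishing BSD". Research route on the
CONSTRUCTION-SHAPED classes X3♯(G-ord)/X4♯(G-ord) (sub-cell additive-p2, gen 21); THEOREMS ONLY —
no definition, no named fact, no conjecture node; labels / RESIDUAL-MAP marks UNCHANGED; nothing
booked.

## What and why

The typed main conjecture `TameBranchRatCharEqAt` (cc-typer-2), its Kato half `TameBranchRatDvdAt`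
(additive-p2 gen 20) and the NAMED FACT A227 `Delbourgo2002.thmC_charIdeal_dvd_tameBranch`
(Delbourgo 2002 Thm (C)) quantify over EVERY tuple `(ε, α, B)` of the interpolation package
`IsTameBranchOf f p ε α B`, whereas print concerns ONE pair `(ε_E, ã_p)`. `TameBranchUnique.lean`
proved `B` unique GIVEN `(ε, α)` and recorded as NOT proved "uniqueness of the unit `α` … and
dependence on `ε` versus `ε̄`" (A227 flag `Del02-ThmC-tuple-robustness`; prose argument in the
A227 module docstring). THIS FILE PROVES IT, for `p` odd:

* **`IsTameBranchOf.tuple_eq`**: `IsTameBranchOf f p ε α B`, `IsTameBranchOf f p ε' α' B'`, `B ≠ 0`,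
  `α' ≠ 0` ⟹ `ε' = ε ∧ α' = α ∧ B' = B`. Proof: the functional equation
  (`IsTameBranchOf.mul_subst_eq`) and its rigidity in `Λ ⊗ ℚ_p`
  (`eq_and_exists_eq_C_mul_of_mul_subst_eq`, Weierstrass preparation) give `α = α'` and `B' = d·B`;
  at a conductor `p^m ≥ p³` free of zeros of `B` (`exists_level_forall_not_hasSum_zero`)
  `τ(ε',ψ_κ) = d·τ(ε,ψ_κ)` for a character `κ` AND all its twists `κ^j`, `p ∤ j`
  (`tameGaussSum_eq_mul_of_eq_C_mul`), whence `ε'(j) = ε(j)` for every unit `j`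
  (`apply_mul_tameGaussSum_pow`), `ε' = ε`, and `d = 1` (`tameGaussSum_ne_zero`).
* `IsTameBranchOf.eq_zero_or_tuple_eq` (dichotomy without `α' ≠ 0`: the other tuples are
  `(ε', 0, 0)`), `IsTameBranchOf.tuple_eq_of_norm_eq_one` (A227's normalisation `‖a‖ = 1`).
* **`forall_isTameBranchOf_iff_of_ne_zero` — the kernel form of the flag**: a property `P` of
  witnesses with `P 0` holds for ALL tuples of the package iff it holds for ONE non-zero witness.
  The conclusion `∃ g ∈ char_Λ X, ∃ k, ι g = p^k · B` of A227 / `TameBranchRatDvdAt` is such a `P`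
  (`g = 0`), so — granted one non-zero E-normalised branch (Mazur–Tate–Teitelbaum + the inverse
  twist identity, the package's named prerequisite; on the census locus the tree's
  `exists_isTameBranchOf_of_ordinaryTwistPartnerAt`, non-vanishing by Rohrlich) — their universal
  quantification over `(ε, a, B)` says NO MORE than the single printed pair: wrong pairs are VACUOUS
  rows. Which pair is Delbourgo's `(ε_E, ã_p)` is not decided here (that is the identification
  `B_E = ε(−1)G(ε̄)⁻¹(Ω⁺_E/Ω⁺_f)(L_p^{an})^Δ` of the A227 docstring, Gauss–Jacobi identity
  `TameGaussJacobi.lean`).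

References: Delbourgo, J. Number Theory 95 (2002) Thm (C) [Delbourgo2002] (the fact whose flag this
retires); Mazur–Tate–Teitelbaum, Invent. Math. 84 (1986) §I.11–I.14 [MazurTateTeitelbaum1986Invent];
Washington, GTM 83, §7 [Washington1997].
-/

noncomputable section

open scoped Classical MatrixGroups ModularForm

open CongruenceSubgroup

namespace Summit.BirchSwinnertonDyer.Rank1Residual.Additive

open Literature.NumberTheory.EllipticCurves Literature.NumberTheory.EllipticCurves.ModularForms
  _root_.PowerSeries

/-! ### §4 Tuple rigidity -/

section Rigidity

variable {p : ℕ} [hp : Fact p.Prime] {N : ℕ} {f : CuspForm (Gamma0 N) 2}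
  {ε ε' : DirichletCharacter ℂ_[p] p} {α α' : ℚ_[p]} {B B' : PowerSeries ℚ_[p]}

/-- From a proportionality `B' = d·B` between two witnesses with the same unit, at a character `κ`
where `B` does not vanish: `τ(ε', ψ_κ) = d · τ(ε, ψ_κ)`. [folklore] -/
theorem IsTameBranchOf.tameGaussSum_eq_mul_of_eq_C_mul (h : IsTameBranchOf f p ε α B)
    (h' : IsTameBranchOf f p ε' α B') {d : ℚ_[p]} (hd : B' = C d * B) (hα : α ≠ 0) {m : ℕ}
    (hm : 2 ≤ m) (κ : DirichletCharacter ℂ_[p] (p ^ m)) (hκ : κ.IsPrimitive) (heven : κ.Even)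
    (hord : ∃ j : ℕ, orderOf κ = p ^ j)
    (hne : ¬ HasSum (fun i ↦ algebraMap ℚ_[p] ℂ_[p] (coeff i B) *
      (κ (cyclotomicGenerator p : ZMod (p ^ m)) - 1) ^ i) 0) :
    tameGaussSum p ε' κ = algebraMap ℚ_[p] ℂ_[p] d * tameGaussSum p ε κ := by
  have hp0 : (p : ℚ_[p]) ≠ 0 := Nat.cast_ne_zero.mpr hp.out.ne_zero
  have hs := h.2.2 m hm κ hκ heven hord
  have hs' := h'.2.2 m hm κ hκ heven hord
  -- the value of `B' = d B` is `d` times the value of `B`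
  have hs'' : HasSum (fun i ↦ algebraMap ℚ_[p] ℂ_[p] (coeff i B') *
      (κ (cyclotomicGenerator p : ZMod (p ^ m)) - 1) ^ i)
      (algebraMap ℚ_[p] ℂ_[p] d * (algebraMap ℚ_[p] ℂ_[p] (α⁻¹ ^ m * (p : ℚ_[p])⁻¹) *
        tameGaussSum p ε κ * ratTwistedSymbolSum f κ)) := by
    refine (hs.mul_left (algebraMap ℚ_[p] ℂ_[p] d)).congr_fun fun i ↦ ?_
    rw [hd, coeff_C_mul, map_mul, mul_assoc]
  have hval := hs'.unique hs''
  -- the symbol sum is non-zero at `κ`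
  have hS : ratTwistedSymbolSum f κ ≠ 0 := by
    intro hS
    rw [hS, mul_zero] at hs
    exact hne hs
  have hc : algebraMap ℚ_[p] ℂ_[p] (α⁻¹ ^ m * (p : ℚ_[p])⁻¹) ≠ 0 := by
    rw [Ne, map_eq_zero_iff _ (algebraMap ℚ_[p] ℂ_[p]).injective]
    exact mul_ne_zero (pow_ne_zero _ (inv_ne_zero hα)) (inv_ne_zero hp0)
  have h1 : algebraMap ℚ_[p] ℂ_[p] (α⁻¹ ^ m * (p : ℚ_[p])⁻¹) * ratTwistedSymbolSum f κ *
      (tameGaussSum p ε' κ - algebraMap ℚ_[p] ℂ_[p] d * tameGaussSum p ε κ) = 0 := by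
    linear_combination hval
  rcases mul_eq_zero.mp h1 with h2 | h2
  · exact absurd h2 (mul_ne_zero hc hS)
  · exact sub_eq_zero.mp h2

/-- **TUPLE RIGIDITY of the E-normalised tame branch.** Let `p` be odd and let `(ε, α, B)` and
`(ε', α', B')` both satisfy the interpolation package `IsTameBranchOf f p · · ·` (same newform
symbol `f`), with `B ≠ 0` and `α' ≠ 0`. Then `ε' = ε`, `α' = α` and `B' = B`: a non-zero bounded
witness determines the tame character, the unit AND the series. (So the universal quantification
over `(ε, a, B)` in `TameBranchRatCharEqAt`, `TameBranchRatDvdAt` and A227 ranges over at most ONE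
tuple with `B ≠ 0`; A227 flag `Del02-ThmC-tuple-robustness`.) Proof: functional equation
(`mul_subst_eq`) + rigidity in `Λ ⊗ ℚ_p` (`eq_and_exists_eq_C_mul_of_mul_subst_eq`) give `α = α'`
and `B' = d·B`; at a conductor `p^m ≥ p³` free of zeros of `B` (`exists_level_forall_not_hasSum_zero`)
`τ(ε',ψ_κ) = d·τ(ε,ψ_κ)` for a character `κ` and all its twists `κ^j`, `p ∤ j`
(`tameGaussSum_eq_mul_of_eq_C_mul`), so `ε'(j) = ε(j)` for every unit `j`
(`apply_mul_tameGaussSum_pow`), `ε' = ε`, and `d = 1` (`tameGaussSum_ne_zero`). [folklore] -/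
theorem IsTameBranchOf.tuple_eq (hp2 : p ≠ 2) (h : IsTameBranchOf f p ε α B)
    (h' : IsTameBranchOf f p ε' α' B') (hB : B ≠ 0) (hα' : α' ≠ 0) :
    ε' = ε ∧ α' = α ∧ B' = B := by
  have hα : α ≠ 0 := h.alpha_ne_zero hB
  have hB' : B' ≠ 0 := h.ne_zero_of_ne_zero h' hB hα'
  -- rigidity of the functional equation
  obtain ⟨hαα, d, hd⟩ := eq_and_exists_eq_C_mul_of_mul_subst_eq h.memIwasawaRat h'.memIwasawaRat
    hB hB' hα (h.mul_subst_eq hp2 h' hα hα')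
  subst hαα
  -- a conductor free of zeros of `B`, and a character there
  obtain ⟨k, -, hk⟩ := exists_level_forall_not_hasSum_zero h.memIwasawaRat hB 0
  haveI : NeZero (Nat.totient (p ^ (k + 3))) :=
    ⟨(Nat.totient_pos.mpr (pow_pos hp.out.pos _)).ne'⟩
  obtain ⟨κ, hκ, heven, hord⟩ := exists_isPrimitive_even_orderOf_eq_prime_pow ℂ_[p] (p := p) k
  have hm : 2 ≤ k + 3 := by omega
  -- `τ(ε', ψ_{κ^j}) = d τ(ε, ψ_{κ^j})` for every unit `j`
  have hrel : ∀ u : (ZMod p)ˣ, tameGaussSum p ε' (κ ^ (u : ZMod p).val) =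
      algebraMap ℚ_[p] ℂ_[p] d * tameGaussSum p ε (κ ^ (u : ZMod p).val) := fun u ↦ by
    have hndvd : ¬ p ∣ (u : ZMod p).val := fun hdvd ↦ by
      have h0 : ((u : ZMod p).val : ZMod p) = 0 := (ZMod.natCast_eq_zero_iff _ _).mpr hdvd
      rw [ZMod.natCast_zmod_val] at h0
      exact u.ne_zero h0
    exact h.tameGaussSum_eq_mul_of_eq_C_mul h' hd hα hm (κ ^ (u : ZMod p).val)
      (isPrimitive_pow_of_not_dvd hm hκ hndvd) (even_pow heven _)
      (exists_orderOf_pow_eq_prime_pow hord _) (hk _ (isPrimitive_pow_of_not_dvd hm hκ hndvd)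
        (even_pow heven _) (exists_orderOf_pow_eq_prime_pow hord _))
  have hrel1 : tameGaussSum p ε' κ = algebraMap ℚ_[p] ℂ_[p] d * tameGaussSum p ε κ := by
    have h1 := hrel 1
    rwa [Units.val_one, ZMod.val_one, pow_one] at h1
  have hτ0 : tameGaussSum p ε' κ ≠ 0 := tameGaussSum_ne_zero hm hκ ε'
  -- `ε' = ε`
  have hεε : ε' = ε := by
    refine MulChar.ext fun u ↦ ?_
    have hu := apply_mul_tameGaussSum_pow hm κ ε u
    have hu' := apply_mul_tameGaussSum_pow hm κ ε' u
    rw [hrel u] at hu'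
    -- `ε' u · d · τ(ε,ψ_{κ^u}) = τ(ε',ψ_κ) = d τ(ε,ψ_κ) = d ε u τ(ε,ψ_{κ^u})`
    have h2 : (ε' u - ε u) * tameGaussSum p ε' κ = 0 := by
      rw [hrel1]
      linear_combination (-(ε' u * algebraMap ℚ_[p] ℂ_[p] d)) * hu + (ε u) * hu' +
        (ε u) * hrel1
    rcases mul_eq_zero.mp h2 with h3 | h3
    · exact (sub_eq_zero.mp h3)
    · exact absurd h3 hτ0
  subst hεε
  -- `d = 1`
  have hd1 : algebraMap ℚ_[p] ℂ_[p] d = 1 := by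
    have h1 : (algebraMap ℚ_[p] ℂ_[p] d - 1) * tameGaussSum p ε' κ = 0 := by
      rw [sub_mul, one_mul, ← hrel1, sub_self]
    rcases mul_eq_zero.mp h1 with h2 | h2
    · exact sub_eq_zero.mp h2
    · exact absurd h2 hτ0
  have hd1' : d = 1 := by
    rwa [← map_one (algebraMap ℚ_[p] ℂ_[p]), (algebraMap ℚ_[p] ℂ_[p]).injective.eq_iff] at hd1
  refine ⟨rfl, rfl, ?_⟩
  rw [hd, hd1', map_one, one_mul]

/-- **Dichotomy form** (no hypothesis on `α'`): given one tuple `(ε, α, B)` with `B ≠ 0`, every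
tuple `(ε', α', B')` of the package is either degenerate (`α' = 0` and `B' = 0`) or equal to it.
[folklore] -/
theorem IsTameBranchOf.eq_zero_or_tuple_eq (hp2 : p ≠ 2) (h : IsTameBranchOf f p ε α B)
    (h' : IsTameBranchOf f p ε' α' B') (hB : B ≠ 0) :
    (α' = 0 ∧ B' = 0) ∨ (ε' = ε ∧ α' = α ∧ B' = B) := by
  by_cases hα' : α' = 0
  · left
    refine ⟨hα', ?_⟩
    by_contra hB'
    exact h'.alpha_ne_zero hB' hα'
  · exact Or.inr (h.tuple_eq hp2 h' hB hα')

/-- **The kernel form of flag `Del02-ThmC-tuple-robustness`**: let `P` be any property of power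
series with `P 0` (e.g. the conclusion `∃ g ∈ char_Λ X, ∃ k, ι g = p^k · B` of A227 /
`TameBranchRatDvdAt` / `TameBranchRatCharEqAt`-divisibility, which holds for `B = 0` with `g = 0`).
If ONE tuple `(ε, α, B)` of the package has `B ≠ 0`, then "`P` holds for EVERY witness of EVERY
tuple" is EQUIVALENT to "`P B`": the universal quantification over `(ε, a, B)` in those statements
says no more than the single pair — wrong pairs are vacuous rows (`p` odd). [folklore] -/
theorem forall_isTameBranchOf_iff_of_ne_zero (hp2 : p ≠ 2) (h : IsTameBranchOf f p ε α B)
    (hB : B ≠ 0) {P : PowerSeries ℚ_[p] → Prop} (hP0 : P 0) :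
    (∀ (ε' : DirichletCharacter ℂ_[p] p) (α' : ℚ_[p]) (B' : PowerSeries ℚ_[p]),
      IsTameBranchOf f p ε' α' B' → P B') ↔ P B := by
  refine ⟨fun hall ↦ hall ε α B h, fun hPB ε' α' B' h' ↦ ?_⟩
  rcases h.eq_zero_or_tuple_eq hp2 h' hB with ⟨-, hB'⟩ | ⟨-, -, hB'⟩
  · rw [hB']; exact hP0
  · rw [hB']; exact hPB

/-- The same with the unit normalised as in A227 (`‖a‖ = 1`, so `a ≠ 0`): every NORMALISED tuple of
the package with a witness coincides with the given one. [folklore] -/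
theorem IsTameBranchOf.tuple_eq_of_norm_eq_one (hp2 : p ≠ 2) (h : IsTameBranchOf f p ε α B)
    (h' : IsTameBranchOf f p ε' α' B') (hB : B ≠ 0) (hα' : ‖α'‖ = 1) :
    ε' = ε ∧ α' = α ∧ B' = B :=
  h.tuple_eq hp2 h' hB (fun h0 ↦ by rw [h0, norm_zero] at hα'; exact zero_ne_one hα')

end Rigidity

end Summit.BirchSwinnertonDyer.Rank1Residual.Additive

end
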